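import Literature.AlgebraicGeometry.Resolution.KollarCoverTriples
import Literature.AlgebraicGeometry.Resolution.GenericFibreResolutionDatum
import Literature.AlgebraicGeometry.Resolution.AffineBlowupUnique
import Literature.AlgebraicGeometry.Resolution.CanonicalResolutionSmoothCentre
import Literature.AlgebraicGeometry.Resolution.ReducedSubschemes
import Literature.AlgebraicGeometry.Resolution.TranslationInvariantIdeals
import Mathlib.RingTheory.KrullDimension.Polynomial
import HarnessLib

/-!
# Kollár's functors blow up a linear subspace of `𝔸ⁿ` at once (Kollár 2007, 3.34.1 / 3.69)

Topic: `Literature/AlgebraicGeometry/Resolution`. A step towards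
`BierstoneGrigorievMilmanWlodarczyk2011_canonicalCharZero` (`CanonicalResolutionSpread.lean`)
from Kollár's Theorem 3.69 in every dimension (`Kollar2007.MarkedOrderReductionInDim`,
`KollarBlowupSequenceFunctors.lean`): the VALUE of a functorial order reduction on the marked
ideal `(𝔸ⁿ_K, 𝓘_L, 1, ∅)` of a coordinate subspace `L = V(xᵢ : i ∈ s)`, `s ≠ ∅`.

* `affineBlowup.idealSheaf_le_idealSheaf_iff`, `…_inj`, `idealSheaf_top`,
  `idealSheaf_eq_top_iff` — the dictionary between ideals of `R` and ideal sheaves on `Spec R`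
  (`affineBlowup.idealSheaf`, `AffineBlowupCartier.lean`) is an order embedding;
* `Kollar2007.Triple.affineSpace K n I hI` — **the triple `(𝔸ⁿ_K, Ĩ, ∅)` of Notation 3.64** for a
  non-zero ideal `I ⊆ K[x₁, …, xₙ]` (`𝔸ⁿ_K` is smooth, integral of dimension `n`);
* `CentreSeq.eq_nil_of_support_eq_empty` — a sequence without empty blow-ups admissible for a
  marked ideal of empty support is empty;
* `Kollar2007.affineSpace_linear_eq_single` — **MAIN: if `B` is a blow-up sequence functor
  on triples of dimension `n` whose values are resolutions without empty blow-ups of the marked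
  ideals `(X, I, 1, E)` (Thm. 3.69 (1) with 3.32) and which commutes with smooth morphisms
  (3.34.1), then `B(𝔸ⁿ_K, 𝓘_L, ∅)` is the single blow-up of `L`.** Proof: by 3.34.1 for the
  translations `τ_a` of `𝔸ⁿ_K` along `L` (automorphisms preserving `𝓘_L`, so
  `B(𝔸ⁿ, 𝓘_L, ∅) = τ_a^* B(𝔸ⁿ, 𝓘_L, ∅)`), the first centre is a translation-invariant ideal
  `𝔠` with `𝓘_L ≤ 𝔠 ≠ ⊤` (it is a non-empty smooth = radical centre inside
  `cosupp(𝓘_L, 1) = L`), hence `𝔠 = 𝓘_L` (`MvPolynomial.eq_span_X_image_of_forall_aeval_mem`,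
  `K` being infinite); after this blow-up the marked ideal is resolved
  (`CentreSeq.single_isResolutionOf`), so no non-empty centre can follow. This is the
  normalization "the canonical resolution of `(U, 𝓘_Z, ∅, 1)`, `Z` smooth, is the blow-up of
  `Z`" (BGMW, proof of Thm. 4.0.6 for `𝓘 = 𝓘_Z`) for the linear model, obtained from
  functoriality alone (Kollár 3.9.1: functorial resolutions are equivariant under group actions).

## Sources

* J. Kollár, *Lectures on Resolution of Singularities*, Ann. of Math. Stud. 166 (2007): 3.9.1,
  3.32, 3.34.1, Notation 3.64, Thm. 3.69 (pp. 121–150 of the held copy). [Kollar2007]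
* E. Bierstone, D. Grigoriev, P. Milman, J. Włodarczyk, *Effective Hironaka resolution and its
  complexity*, Asian J. Math. 15 (2011), proof of Thm. 4.0.6 (arXiv:1206.3090, pp. 11–13).
  [BierstoneGrigorievMilmanWlodarczyk2011]
-/

noncomputable section

open CategoryTheory CategoryTheory.Limits AlgebraicGeometry TopologicalSpace

namespace Literature.AlgebraicGeometry.Resolution

universe u

/-! ## Ideals of `R` and ideal sheaves on `Spec R` -/

section Dictionary

variable {R : Type u} [CommRing R]

/-- The dictionary `I ↦ Ĩ` reflects and preserves inclusions. [folklore] -/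
theorem affineBlowup.idealSheaf_le_idealSheaf_iff {I J : Ideal R} :
    affineBlowup.idealSheaf I ≤ affineBlowup.idealSheaf J ↔ I ≤ J := by
  let e := Scheme.ΓSpecIso (CommRingCat.of R)
  have key : I.map e.inv.hom ≤ J.map e.inv.hom ↔ I ≤ J := by
    constructor
    · intro h
      have h' := Ideal.map_mono (f := e.hom.hom) h
      rwa [Ideal.map_map, Ideal.map_map, ← CommRingCat.hom_comp, e.inv_hom_id,
        CommRingCat.hom_id, Ideal.map_id, Ideal.map_id] at h'
    · exact fun h => Ideal.map_mono h
  unfold affineBlowup.idealSheaf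
  rw [← Scheme.IdealSheafData.equivOfIsAffine_symm_apply,
    ← Scheme.IdealSheafData.equivOfIsAffine_symm_apply, map_le_map_iff, key]

/-- The dictionary `I ↦ Ĩ` is injective. [folklore] -/
theorem affineBlowup.idealSheaf_inj {I J : Ideal R} :
    affineBlowup.idealSheaf I = affineBlowup.idealSheaf J ↔ I = J := by
  simp only [le_antisymm_iff, affineBlowup.idealSheaf_le_idealSheaf_iff]

/-- The ideal sheaf of the unit ideal is the unit ideal sheaf. [folklore] -/
theorem affineBlowup.idealSheaf_top : affineBlowup.idealSheaf (⊤ : Ideal R) = ⊤ := by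
  rw [← Scheme.IdealSheafData.support_eq_bot_iff]
  ext1
  rw [affineBlowup.support_idealSheaf, TopologicalSpace.Closeds.coe_bot]
  exact PrimeSpectrum.zeroLocus_empty_iff_eq_top.mpr rfl

/-- `Ĩ = 𝒪` iff `I = R`. [folklore] -/
theorem affineBlowup.idealSheaf_eq_top_iff {I : Ideal R} :
    affineBlowup.idealSheaf I = ⊤ ↔ I = ⊤ := by
  rw [← affineBlowup.idealSheaf_top (R := R), affineBlowup.idealSheaf_inj]

/-- `Ĩ = 0` iff `I = 0`. [folklore] -/
theorem affineBlowup.idealSheaf_eq_bot_iff {I : Ideal R} :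
    affineBlowup.idealSheaf I = ⊥ ↔ I = ⊥ := by
  constructor
  · intro h
    obtain ⟨J, hJ⟩ := affineBlowup.exists_eq_idealSheaf (⊥ : (Spec (CommRingCat.of R)).IdealSheafData)
    have hle : affineBlowup.idealSheaf I ≤ affineBlowup.idealSheaf (⊥ : Ideal R) := by
      rw [h]
      exact bot_le
    exact le_bot_iff.mp (affineBlowup.idealSheaf_le_idealSheaf_iff.mp hle)
  · rintro rfl
    apply le_bot_iff.mp
    obtain ⟨J, hJ⟩ := affineBlowup.exists_eq_idealSheaf (⊥ : (Spec (CommRingCat.of R)).IdealSheafData)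
    rw [hJ, affineBlowup.idealSheaf_le_idealSheaf_iff]
    exact bot_le

end Dictionary

/-! ## A sequence without empty blow-ups over an empty support is empty -/

namespace CentreSeq

variable {X : Scheme.{u}}

/-- **A sequence without empty blow-ups that is admissible for a marked ideal of empty support
is the empty sequence** (its first centre would be a non-empty subscheme of `supp = ∅`).
[cite: Kollar2007, 3.32 (p. 130)] -/
theorem eq_nil_of_support_eq_empty : ∀ {X : Scheme.{u}} (s : CentreSeq X) (M : MarkedIdeal X),
    s.IsAdmissibleFor M → s.NoEmptyCentres → M.support = ∅ → s = nil X
  | _, nil _, _, _, _, _ => rfl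
  | _, cons C rest, M, hadm, hne, hM => by
    exfalso
    apply hne.1
    rw [← Scheme.IdealSheafData.support_eq_bot_iff]
    ext1
    rw [TopologicalSpace.Closeds.coe_bot]
    exact Set.subset_empty_iff.mp (hM ▸ hadm.1)

/-- A resolution without empty blow-ups of a marked ideal of multiplicity one whose ideal is a
smooth centre having simple normal crossings with the boundary, and whose FIRST centre is that
ideal, is the one-step sequence (after the first blow-up the support is empty,
`single_isResolutionOf`). [cite: BierstoneGrigorievMilmanWlodarczyk2011, §4 proof of Thm. 4.0.6 (Step 2a)] -/
theorem cons_eq_single_of_isResolutionOf {C : X.IdealSheafData} {E : List X.IdealSheafData}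
    {rest : CentreSeq (blowup C)} (hres : (cons C rest).IsResolutionOf ⟨C, E, 1⟩)
    (hne : (cons C rest).NoEmptyCentres) : cons C rest = single C := by
  have hsnc : HasSNCWith E C := ((isAdmissibleFor_cons C rest _).mp hres.1).2.1
  have hreg : Scheme.IsRegular C.subscheme := ((isAdmissibleFor_cons C rest _).mp hres.1).2.2.1
  have hempty : (MarkedIdeal.transform (blowup.π C) C ⟨C, E, 1⟩).support = ∅ :=
    (single_isResolutionOf hsnc hreg).2
  have hrest : rest = nil _ :=
    eq_nil_of_support_eq_empty rest _ ((isAdmissibleFor_cons C rest _).mp hres.1).2.2.2 hne.2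
      hempty
  rw [hrest]
  rfl

end CentreSeq

/-! ## The triple `(𝔸ⁿ_K, Ĩ, ∅)` -/

namespace Kollar2007.Triple

variable (K : Type u) [Field K] (n : ℕ)

/-- `𝔸ⁿ_K → Spec K` is locally of finite type. [folklore] -/
instance locallyOfFiniteType_affineSpace_struct :
    LocallyOfFiniteType (Spec.map (CommRingCat.ofHom (algebraMap K (MvPolynomial (Fin n) K)))) := by
  rw [HasRingHomProperty.Spec_iff (P := @LocallyOfFiniteType)]
  exact RingHom.finiteType_algebraMap.mpr inferInstance

/-- `𝔸ⁿ_K` is equidimensional of dimension `n` (irreducible of Krull dimension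
`dim K[x₁, …, xₙ] = n`). [folklore] -/
theorem affineSpace_equidim :
    ∀ Z ∈ irreducibleComponents (Spec (CommRingCat.of (MvPolynomial (Fin n) K)) : Type u),
      topologicalKrullDim Z = n := by
  intro Z hZ
  rw [irreducibleComponents_eq_singleton, Set.mem_singleton_iff] at hZ
  subst hZ
  rw [IsHomeomorph.topologicalKrullDim_eq _
      (Homeomorph.Set.univ (Spec (CommRingCat.of (MvPolynomial (Fin n) K)) : Type u)).isHomeomorph]
  change topologicalKrullDim (PrimeSpectrum (MvPolynomial (Fin n) K)) = n
  rw [PrimeSpectrum.topologicalKrullDim_eq_ringKrullDim,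
    MvPolynomial.ringKrullDim_of_isNoetherianRing, ringKrullDim_eq_zero_of_field]
  simp

variable {K n} in
/-- **The triple `(𝔸ⁿ_K, Ĩ, ∅)` of Kollár's Notation 3.64** for a non-zero ideal
`I ⊆ K[x₁, …, xₙ]`: `𝔸ⁿ_K` is smooth of finite type and equidimensional of dimension `n` over
`K`, `Ĩ ≠ 0` has no vanishing stalk (`𝔸ⁿ_K` is integral), and the boundary is empty.
[cite: Kollar2007, Notation 3.64 (p. 148)] -/
@[reducible] def affineSpace (I : Ideal (MvPolynomial (Fin n) K)) (hI : I ≠ ⊥) : Triple K n where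
  X := Spec (CommRingCat.of (MvPolynomial (Fin n) K))
  struct := Spec.map (CommRingCat.ofHom (algebraMap K (MvPolynomial (Fin n) K)))
  isRegular := Scheme.isRegular_Spec _
  equidim := affineSpace_equidim K n
  ideal := affineBlowup.idealSheaf I
  stalkIdeal_ne_bot := stalkIdeal_ne_bot_of_ne_bot
    (fun h => hI (affineBlowup.idealSheaf_eq_bot_iff.mp h))
  boundary := []
  hasSNC := hasSNC_nil_of_isRegular (Scheme.isRegular_Spec _)
  boundary_pairwise := List.Pairwise.nil

variable {K n}

/-- Unfolding. [folklore] -/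
@[simp] theorem affineSpace_X (I : Ideal (MvPolynomial (Fin n) K)) (hI : I ≠ ⊥) :
    (affineSpace I hI).X = Spec (CommRingCat.of (MvPolynomial (Fin n) K)) := rfl

/-- Unfolding. [folklore] -/
@[simp] theorem affineSpace_ideal (I : Ideal (MvPolynomial (Fin n) K)) (hI : I ≠ ⊥) :
    (affineSpace I hI).ideal = affineBlowup.idealSheaf I := rfl

/-- Unfolding. [folklore] -/
@[simp] theorem affineSpace_boundary (I : Ideal (MvPolynomial (Fin n) K)) (hI : I ≠ ⊥) :
    (affineSpace I hI).boundary = [] := rfl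

/-- Unfolding. [folklore] -/
@[simp] theorem affineSpace_struct (I : Ideal (MvPolynomial (Fin n) K)) (hI : I ≠ ⊥) :
    (affineSpace I hI).struct =
      Spec.map (CommRingCat.ofHom (algebraMap K (MvPolynomial (Fin n) K))) := rfl

/-- **`(𝔸ⁿ_K, Ĩ, ∅)` is its own pull-back along `Spec σ` for every `K`-algebra automorphism `σ`
of `K[x₁, …, xₙ]` preserving `I`** (`Triple.IsPullbackAlong`). [cite: Kollar2007, 3.34.1 (p. 131)] -/
theorem affineSpace_isPullbackAlong_specMap (I : Ideal (MvPolynomial (Fin n) K)) (hI : I ≠ ⊥)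
    (σ : MvPolynomial (Fin n) K →ₐ[K] MvPolynomial (Fin n) K) (hσ : I.map σ = I) :
    (affineSpace I hI).IsPullbackAlong (affineSpace I hI)
      (Spec.map (CommRingCat.ofHom (σ : MvPolynomial (Fin n) K →+* MvPolynomial (Fin n) K))) := by
  refine ⟨?_, ?_, rfl⟩
  · change Spec.map (CommRingCat.ofHom (σ : MvPolynomial (Fin n) K →+* MvPolynomial (Fin n) K)) ≫
        Spec.map (CommRingCat.ofHom (algebraMap K (MvPolynomial (Fin n) K))) =
      Spec.map (CommRingCat.ofHom (algebraMap K (MvPolynomial (Fin n) K)))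
    rw [← Spec.map_comp, ← CommRingCat.ofHom_comp, σ.comp_algebraMap]
  · change affineBlowup.idealSheaf I =
      (affineBlowup.idealSheaf I).comap
        (Spec.map (CommRingCat.ofHom (σ : MvPolynomial (Fin n) K →+* MvPolynomial (Fin n) K)))
    rw [affineBlowup.comap_idealSheaf_specMap]
    change affineBlowup.idealSheaf I = affineBlowup.idealSheaf (I.map σ)
    rw [hσ]

end Kollar2007.Triple

/-! ## The value of a functorial order reduction on `(𝔸ⁿ_K, 𝓘_L, 1, ∅)` -/

section Linear

open _root_.MvPolynomial Kollar2007

variable {K : Type u} [Field K] {n : ℕ}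

/-- The ideal `(xᵢ : i ∈ s)` of a coordinate subspace is proper (it is killed by evaluation at
`0`). [folklore] -/
theorem span_X_image_ne_top (s : Set (Fin n)) :
    Ideal.span (X '' s : Set (MvPolynomial (Fin n) K)) ≠ ⊤ := by
  intro h
  have hle : Ideal.span (X '' s : Set (MvPolynomial (Fin n) K)) ≤
      RingHom.ker (eval (fun _ => (0 : K))) := by
    rw [Ideal.span_le]
    rintro _ ⟨i, -, rfl⟩
    simp
  rw [h, top_le_iff] at hle
  exact RingHom.ker_ne_top _ hle

/-- The ideal `(xᵢ : i ∈ s)` of a coordinate subspace is non-zero when `s ≠ ∅`. [folklore] -/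
theorem span_X_image_ne_bot {s : Set (Fin n)} (hs : s.Nonempty) :
    Ideal.span (X '' s : Set (MvPolynomial (Fin n) K)) ≠ ⊥ := by
  obtain ⟨i, hi⟩ := hs
  intro h
  have : (X i : MvPolynomial (Fin n) K) ∈ Ideal.span (X '' s : Set (MvPolynomial (Fin n) K)) :=
    Ideal.subset_span ⟨i, hi, rfl⟩
  rw [h, Ideal.mem_bot] at this
  exact X_ne_zero i this

/-- The translation `xᵢ ↦ xᵢ + aᵢ` of `K[x₁, …, xₙ]` as a `K`-algebra automorphism (inverse
`xᵢ ↦ xᵢ - aᵢ`). [folklore] -/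
def translateEquiv (a : Fin n → K) : MvPolynomial (Fin n) K ≃ₐ[K] MvPolynomial (Fin n) K :=
  AlgEquiv.ofAlgHom (aeval fun i => X i + C (a i)) (aeval fun i => X i - C (a i))
    (by
      refine algHom_ext fun i => ?_
      simp only [AlgHom.comp_apply, aeval_X, map_sub, aeval_C, AlgHom.id_apply]
      rw [MvPolynomial.algebraMap_eq]
      ring)
    (by
      refine algHom_ext fun i => ?_
      simp only [AlgHom.comp_apply, aeval_X, map_add, aeval_C, AlgHom.id_apply]
      rw [MvPolynomial.algebraMap_eq]
      ring)

/-- Unfolding. [folklore] -/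
@[simp] theorem translateEquiv_apply (a : Fin n → K) (p : MvPolynomial (Fin n) K) :
    translateEquiv a p = aeval (fun i => X i + C (a i)) p := rfl

/-- A translation along `L = V(xᵢ : i ∈ s)` (`aᵢ = 0` for `i ∈ s`) preserves `𝓘_L`. [folklore] -/
theorem map_translateEquiv_span_X_image {s : Set (Fin n)} {a : Fin n → K}
    (ha : ∀ i ∈ s, a i = 0) :
    (Ideal.span (X '' s : Set (MvPolynomial (Fin n) K))).map (translateEquiv a : _ →ₐ[K] _) =
      Ideal.span (X '' s : Set (MvPolynomial (Fin n) K)) := by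
  rw [Ideal.map_span]
  congr 1
  ext p
  constructor
  · rintro ⟨_, ⟨i, hi, rfl⟩, rfl⟩
    refine ⟨i, hi, ?_⟩
    change X i = translateEquiv a (X i)
    rw [translateEquiv_apply, aeval_X, ha i hi, C_0, add_zero]
  · rintro ⟨i, hi, rfl⟩
    refine ⟨X i, ⟨i, hi, rfl⟩, ?_⟩
    change translateEquiv a (X i) = X i
    rw [translateEquiv_apply, aeval_X, ha i hi, C_0, add_zero]

/-- **Kollár's functorial order reduction blows up a coordinate subspace at once.** Let `B` be a
blow-up sequence functor on triples of dimension `n` (Def. 3.31) such that, over the field `K` of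
characteristic zero, `B(X, I, E)` is a resolution of `(X, I, 1, E)` without empty blow-ups
(Thm. 3.69 (1) with the convention 3.32) and `B` commutes with smooth morphisms (3.34.1). Then
for every non-empty `s ⊆ {1, …, n}`, with `L = V(xᵢ : i ∈ s) ⊆ 𝔸ⁿ_K`,
`B(𝔸ⁿ_K, 𝓘_L, ∅)` is the one-step sequence blowing up `𝓘_L`. (Translation invariance of the
first centre via 3.34.1 for the automorphisms `xᵢ ↦ xᵢ + aᵢ`, `a|ₛ = 0`, then
`MvPolynomial.eq_span_X_image_of_forall_aeval_mem`; BGMW, proof of Thm. 4.0.6 for `𝓘 = 𝓘_Z`.)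
[cite: Kollar2007, 3.34.1 (p. 131) with 3.9.1 and Thm. 3.69 (p. 150)] -/
theorem Kollar2007.affineSpace_linear_eq_single [CharZero K] {s : Set (Fin n)}
    (hs : s.Nonempty) {B : BlowupSequenceFunctor.{u} n}
    (hB : ∀ T : Triple K n, (B T).IsResolutionOf (T.marked 1) ∧ (B T).NoEmptyCentres)
    (hBs : CommutesWithSmoothMorphisms (TripleClass.all n) B) :
    B (Triple.affineSpace (Ideal.span (MvPolynomial.X '' s : Set (MvPolynomial (Fin n) K)))
        (span_X_image_ne_bot hs)) =
      CentreSeq.single (affineBlowup.idealSheaf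
        (Ideal.span (MvPolynomial.X '' s : Set (MvPolynomial (Fin n) K)))) := by
  classical
  set I : Ideal (MvPolynomial (Fin n) K) :=
    Ideal.span (MvPolynomial.X '' s : Set (MvPolynomial (Fin n) K)) with hIdef
  set T : Triple K n := Triple.affineSpace I (span_X_image_ne_bot hs) with hTdef
  obtain ⟨hres, hne⟩ := hB T
  -- the sequence is not empty: `supp(𝓘_L, 1) = L ≠ ∅`
  have hsupp : (T.marked 1).support = PrimeSpectrum.zeroLocus (I : Set (MvPolynomial (Fin n) K)) := by
    rw [MarkedIdeal.support_of_mult_eq_one _ rfl]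
    exact affineBlowup.support_idealSheaf I
  have hnonempty : (T.marked 1).support.Nonempty := by
    rw [hsupp, Set.nonempty_iff_ne_empty]
    intro h
    exact span_X_image_ne_top s
      ((PrimeSpectrum.zeroLocus_empty_iff_eq_top (R := MvPolynomial (Fin n) K)).mp h)
  -- first centre `C` and the rest
  obtain ⟨C₀, rest, hBT⟩ : ∃ (C₀ : T.X.IdealSheafData) (rest : CentreSeq (blowup C₀)),
      B T = CentreSeq.cons C₀ rest := by
    match hBT : B T with
    | CentreSeq.nil _ =>
      exfalso
      rw [hBT, CentreSeq.isResolutionOf_nil_iff] at hres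
      exact hnonempty.ne_empty hres
    | CentreSeq.cons C₀ rest => exact ⟨C₀, rest, rfl⟩
  rw [hBT] at hres hne
  -- `C = 𝔠~` for an ideal `𝔠` of `K[x]`
  obtain ⟨𝔠, h𝔠⟩ := affineBlowup.exists_eq_idealSheaf C₀
  have hadm := (CentreSeq.isAdmissibleFor_cons C₀ rest _).mp hres.1
  -- `𝔠 ≠ ⊤`: no empty blow-ups
  have h𝔠top : 𝔠 ≠ ⊤ := fun h => hne.1 (by rw [h𝔠, h, affineBlowup.idealSheaf_top])
  -- `I ≤ 𝔠`: the centre is a radical ideal sheaf inside `cosupp(𝓘_L, 1) = V(I)`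
  have hI𝔠 : I ≤ 𝔠 := by
    have hrad : C₀.radical = C₀ :=
      (isReduced_subscheme_iff_radical_eq C₀).mp hadm.2.2.1.isReduced
    have h1 : C₀.support ≤ (affineBlowup.idealSheaf I).support := by
      intro x hx
      have := hadm.1 hx
      rwa [MarkedIdeal.support_of_mult_eq_one _ rfl] at this
    have h2 : affineBlowup.idealSheaf I ≤ C₀ := by
      calc affineBlowup.idealSheaf I
          ≤ Scheme.IdealSheafData.vanishingIdeal (affineBlowup.idealSheaf I).support :=
            Scheme.IdealSheafData.le_support_iff_le_vanishingIdeal.mp le_rfl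
        _ ≤ Scheme.IdealSheafData.vanishingIdeal C₀.support :=
            Scheme.IdealSheafData.vanishingIdeal_antimono h1
        _ = C₀ := by rw [Scheme.IdealSheafData.vanishingIdeal_support, hrad]
    rw [h𝔠, affineBlowup.idealSheaf_le_idealSheaf_iff] at h2
    exact h2
  -- translation invariance of `𝔠` (3.34.1 for the automorphisms `τ_a`)
  have hinv : ∀ a : Fin n → K, (∀ i ∈ s, a i = 0) →
      ∀ p ∈ 𝔠, aeval (fun i => X i + C (a i)) p ∈ 𝔠 := by
    intro a ha p hp
    let σ : MvPolynomial (Fin n) K ≃ₐ[K] MvPolynomial (Fin n) K := translateEquiv a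
    let τ : T.X ⟶ T.X :=
      Spec.map (CommRingCat.ofHom ((σ : MvPolynomial (Fin n) K →ₐ[K] MvPolynomial (Fin n) K) :
        MvPolynomial (Fin n) K →+* MvPolynomial (Fin n) K))
    haveI : IsIso τ := by
      change IsIso (Spec.map (σ.toRingEquiv.toCommRingCatIso).hom)
      infer_instance
    have hpb : T.IsPullbackAlong T τ :=
      Triple.affineSpace_isPullbackAlong_specMap I (span_X_image_ne_bot hs)
        (σ : MvPolynomial (Fin n) K →ₐ[K] MvPolynomial (Fin n) K)
        (map_translateEquiv_span_X_image ha)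
    have hcomm := (hBs T T τ trivial trivial hpb).1 inferInstance
    rw [hBT, CentreSeq.comap_cons] at hcomm
    have hC : C₀ = C₀.comap τ := (CentreSeq.cons.injEq _ _ _ _ ▸ hcomm :).1
    rw [h𝔠] at hC
    change affineBlowup.idealSheaf 𝔠 = (affineBlowup.idealSheaf 𝔠).comap
      (Spec.map (CommRingCat.ofHom
        ((σ : MvPolynomial (Fin n) K →ₐ[K] MvPolynomial (Fin n) K) :
          MvPolynomial (Fin n) K →+* MvPolynomial (Fin n) K))) at hC
    rw [affineBlowup.comap_idealSheaf_specMap, affineBlowup.idealSheaf_inj] at hC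
    have : σ p ∈ 𝔠.map ((σ : MvPolynomial (Fin n) K →ₐ[K] MvPolynomial (Fin n) K) :
        MvPolynomial (Fin n) K →+* MvPolynomial (Fin n) K) :=
      Ideal.mem_map_of_mem _ hp
    rw [← hC] at this
    exact this
  -- hence `𝔠 = I` and `C = 𝓘_L`
  haveI : Infinite K := Infinite.of_injective _ Nat.cast_injective
  have h𝔠I : 𝔠 = I := MvPolynomial.eq_span_X_image_of_forall_aeval_mem s h𝔠top hI𝔠 hinv
  subst h𝔠I
  -- `C = T.ideal`; after blowing it up the marked ideal is resolved, so the rest is empty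
  have hCT : C₀ = T.ideal := h𝔠
  subst hCT
  rw [hBT]
  exact CentreSeq.cons_eq_single_of_isResolutionOf hres hne

end Linear

end Literature.AlgebraicGeometry.Resolution

end
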